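import Summits.NavierStokesRegularity.NavierStokesRegularity.Theses.AxisymmetricExtremality
import Summits.NavierStokesRegularity.NavierStokesRegularity.Theorems.AxisymmetricExtremalityAxisymmetricKatoGlobalNoSwirlStratum
import Literature.Analysis.FluidPDE.AxisymmetricReflection
import Literature.Analysis.FluidPDE.KatoMaximalTime
import HarnessLib.Audit

/-!
# Strategist s20-g6 (family `s`, independent census) — typed census objects for the crux
`AxisymmetricKatoGlobal` (item stmt-NavierStokesRegularity-15453) of
route-NavierStokesRegularity-AxisymmetricExtremality.

Nothing here is a new route item and nothing is registered as a line: these are the SIGNATURES the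
census `STRATEGY-CENSUS-s20-g6.md` refers to, kernel-checked so that the census talks about real
statements.  Sorry-free.

* `NoAxisymMinimalBlowup`            — W0, the threshold instance that `closes` actually consumes;
* `closes_of_threshold`              — the route's deciding theorem re-glued on W0 (pure logic);
* `noAxisymMinimalBlowup_of_crux`    — crux ⇒ W0 (so W0 is formally weaker);
* `AxisymmetricKatoGlobalReflY`      — W_{O(2)}: the crux on data also equivariant under the
                                       meridian reflection; PROVED (`…_holds`) from the landed
                                       no-swirl stratum — the one instance with teeth, usable only
                                       after a route-level re-glue (idea `dihedral-smith-bypass`);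
* `AprioriCriticalBound`             — S⁺ (strengthen): an a-priori bound of the Ḣ^{1/2} norm
                                       along axisymmetric Kato solutions (typed only);
* `SmoothAxisymKatoGlobal`           — W2: the crux restricted to smooth data (typed only; = ns.S25
                                       in the Kato class).
-/

namespace Summit.NavierStokesRegularity.NavierStokesRegularity.Cruxes.AxisymmetricKatoGlobal.StrategistS20g6

open Literature.Analysis.FluidPDE Literature.Analysis.FunctionSpaces MeasureTheory Set Filter Topology
open Summit.NavierStokesRegularity.NavierStokesRegularity.Theses.AxisymmetricExtremality
open scoped ENNReal

local notation "ℝ³" => EuclideanSpace ℝ (Fin 3)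
local notation "ℂ³" => EuclideanSpace ℂ (Fin 3)

/-! ## W0 — the threshold instance consumed by `closes` -/

/-- **W0.** No Rusin–Šverák `Ḣ^{1/2}`-minimal blow-up datum is axisymmetric.  This is literally
the only instance of the crux used by the route's deciding theorem. -/
def NoAxisymMinimalBlowup : Prop :=
  ∀ ν : ℝ, 0 < ν → ∀ (u₀ : ℝ³ → ℝ³) (g : HomSobolev ℝ³ ℂ³ (1 / 2 : ℝ)),
    IsMinimalBlowupDatum ν u₀ g → IsAxisymmetric u₀ → False

/-- crux ⇒ W0 (W0 is formally weaker than the crux). -/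
theorem noAxisymMinimalBlowup_of_crux (h : AxisymmetricKatoGlobal) : NoAxisymMinimalBlowup := by
  intro ν hν u₀ g hmin hax
  obtain ⟨hL3, hrep, hdiv, -, hnot⟩ := hmin
  exact hnot (h ν hν u₀ g hL3 hrep hdiv (fun θ x => hax θ x))

/-- The route's deciding theorem re-glued on W0 instead of the crux: pure logic, the same
three lines as `Theses.AxisymmetricExtremality.closes`. -/
theorem closes_of_threshold (h₂ : MinimalDatumPFold) (h₄ : PFoldToAxisymmetric)
    (h₀ : NoAxisymMinimalBlowup) : NavierStokesRegularity := by
  show Literature.NS.NavierStokesExistenceSmoothR3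
  intro ν hν u₀ hsm hdiv hdec
  by_contra hno
  obtain ⟨u₁, g, hmin, hax⟩ := h₄ ν hν (h₂ ν hν ⟨u₀, hsm, hdiv, hdec, hno⟩)
  exact h₀ ν hν u₁ g hmin (fun θ x => hax θ x)

/-! ## W_{O(2)} — the instance with teeth (transfer from the solved no-swirl sibling) -/

/-- **W_{O(2)}.** The crux restricted to data that are, in addition, equivariant under the
meridian reflection `σ = reflY` (`(x₀,x₁,x₂) ↦ (x₀,−x₁,x₂)`), i.e. under the full `O(2)` about
the axis. -/
def AxisymmetricKatoGlobalReflY : Prop :=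
  ∀ ν : ℝ, 0 < ν → ∀ (u₀ : ℝ³ → ℝ³) (g : HomSobolev ℝ³ ℂ³ (1 / 2 : ℝ)),
    MemLp u₀ 3 volume → g.Represents (Literature.Analysis.FunctionSpaces.EuclideanSpace.complexify ∘ u₀) →
    IsWeaklyDivFree u₀ → IsAxisymmetric u₀ → (∀ x, u₀ (reflY x) = reflY (u₀ x)) →
    HasGlobalKatoSolution ν u₀

/-- **W_{O(2)} is a theorem**: `O(2)`-equivariance kills the swirl
(`IsAxisymmetric.hasNoSwirl_of_reflY_eq`) and the swirl-free stratum of the crux is landed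
(`NoSwirlStratum.axisymmetricKatoGlobal_noSwirl_stratum`). -/
theorem axisymmetricKatoGlobalReflY_holds : AxisymmetricKatoGlobalReflY := by
  intro ν hν u₀ g hL3 _hrep hdiv hax hσ
  exact Theorems.AxisymmetricKatoGlobal.NoSwirlStratum.axisymmetricKatoGlobal_noSwirl_stratum ν hν u₀
    hL3 hdiv (fun θ x => hax θ x) (hax.hasNoSwirl_of_reflY_eq hσ)

/-- The crux trivially gives W_{O(2)} (recorded so that the census's "instance" claim is literal). -/
theorem axisymmetricKatoGlobalReflY_of_crux (h : AxisymmetricKatoGlobal) :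
    AxisymmetricKatoGlobalReflY :=
  fun ν hν u₀ g hL3 hrep hdiv hax _ => h ν hν u₀ g hL3 hrep hdiv (fun θ x => hax θ x)

/-! ## S⁺ — strengthen: an a-priori critical bound (typed only) -/

/-- **S⁺.** Along every axisymmetric Kato solution on `[0,T)` issued from a datum represented by
`g ∈ Ḣ^{1/2}`, every `Ḣ^{1/2}`-representative of a later slice is bounded by a finite function of
`‖g‖`.  (With Kenig–Koch / Gallagher–Koch–Planchon "critical elements" this gives the crux; it is
the missing a-priori input itself — see the census § Strengthen.) -/
def AprioriCriticalBound : Prop :=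
  ∀ ν : ℝ, 0 < ν → ∃ F : ℝ≥0∞ → ℝ≥0∞, (∀ a, a < ⊤ → F a < ⊤) ∧
    ∀ T : ℝ, 0 < T → ∀ (u₀ : ℝ³ → ℝ³) (g : HomSobolev ℝ³ ℂ³ (1 / 2 : ℝ)) (u : ℝ → ℝ³ → ℝ³),
      g.Represents (Literature.Analysis.FunctionSpaces.EuclideanSpace.complexify ∘ u₀) →
      IsKatoSolutionOn T ν u₀ u → IsAxisymmetric u₀ →
      ∀ t ∈ Ioo 0 T, ∀ g' : HomSobolev ℝ³ ℂ³ (1 / 2 : ℝ),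
        g'.Represents (Literature.Analysis.FunctionSpaces.EuclideanSpace.complexify ∘ u t) → ‖g'‖ₑ ≤ F ‖g‖ₑ

/-! ## W2 — the smooth-data instance (typed only; = ns.S25 in the Kato class) -/

/-- **W2.** The crux for smooth data only.  Equivalent to the crux modulo the Kato flow to a
positive time (smoothing) — hence not easier; it is `AxisymmetricSwirlRegularity` (ns.S25) phrased
in the Kato class without the rapid-decay / bounded-energy clauses. -/
def SmoothAxisymKatoGlobal : Prop :=
  ∀ ν : ℝ, 0 < ν → ∀ (u₀ : ℝ³ → ℝ³) (g : HomSobolev ℝ³ ℂ³ (1 / 2 : ℝ)),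
    ContDiff ℝ (⊤ : ℕ∞) u₀ → MemLp u₀ 3 volume →
    g.Represents (Literature.Analysis.FunctionSpaces.EuclideanSpace.complexify ∘ u₀) →
    IsWeaklyDivFree u₀ → IsAxisymmetric u₀ → HasGlobalKatoSolution ν u₀

/-- crux ⇒ W2 (trivial direction; the converse needs the flow-to-positive-time transfer). -/
theorem smoothAxisymKatoGlobal_of_crux (h : AxisymmetricKatoGlobal) : SmoothAxisymKatoGlobal :=
  fun ν hν u₀ g _ hL3 hrep hdiv hax => h ν hν u₀ g hL3 hrep hdiv (fun θ x => hax θ x)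

end Summit.NavierStokesRegularity.NavierStokesRegularity.Cruxes.AxisymmetricKatoGlobal.StrategistS20g6
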